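import Mathlib
import HarnessLib
import Summits.Ventures.LatticeQCDFlow.Exactness.NCMCGeneralSpaceSampleSizeCorrelated

/-!
# NCMCGeneralSpaceSampleSizeVarianceInflation — the correlated-draws sufficiency law in CLASS form
# (`L²` class / bounded class, `N ≥ e^{L + t}`) and its docking to Crooks pairs: Jarzynski /
# reweighting from CORRELATED forward records with `P_F` marginals and variance inflation `C`;
# `N/C ≥ e^{t}/ESS_F` suffices

HONEST FRAMING: exact (Metropolis-corrected) sampling algorithms for lattice gauge theory;
figures of merit are autocorrelation/cost numbers at stated couplings and volumes; no
continuum-physics claim.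

Venture `LatticeQCDFlow` (cell pub-lqcd); FANOUT row 19 (`su2-snf`, GEN-8).  OUR WORK (elementary /
bookkeeping over row 13's `Exactness/NCMCGeneralSpace*` framework); nothing is cited as a fact.
`Exactness/NCMCGeneralSpaceSampleSizeCorrelated` (whose docstring announces this file's §2 under the
working name `…SampleSizeCorrelatedCrooks`) proves the SUFFICIENCY half of the Chatterjee–Diaconis
sample-size law (Literature, Ann. Appl. Probab. 28 (2018) Thm 1.1, proved there for i.i.d. draws)
for any joint law `Q` of `N` draws with identical proposal marginals `μ`, in threshold form and with
the single variance input the printed proof uses.  §1 states the two CLASS forms a user checks once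
for a sampling scheme — a variance-inflation factor `C` valid for every `g ∈ L²(μ)` (spectral-gap
type), or for every BOUNDED measurable `g` (Doeblin / total-variation type, the class of row 8's
`Scoring/RestartChainAutocorrelation` and row 11's `Scoring/ChainTimeAverage`) — and converts the
threshold `a = e^{L + t/2}` into the sample-size statement `N ≥ e^{L + t}`, `L = ∫ log ρ dν = D(ν ‖ μ)`.
§2 docks them to row 13's Crooks pairs: proposal = forward record law `P_F = fwdPathLaw ν₀ κF`,
target = reverse record law `P_R = fwdPathLaw ν₁ κR`, `dP_R/dP_F = e^{ΔF − W}`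
(`Exactness/NCMCGeneralSpaceRelativeEntropy.revPathLaw_eq_withDensity`), exponent
`KL(P_R ‖ P_F) = E_{P_R}[ΔF − W]` (the mean work dissipated by the REVERSE process); `Q` is ANY
probability law of `N` forward records with `P_F` one-record marginals — e.g. the records launched
every `n_between` sweeps from a STATIONARY prior chain (rows 8 / 13 / 19 / 23).

§1 (general):
* `sqrt_mul_threshold_div_le`, `toReal_measure_threshold_le_log` — threshold-to-sample-size
  conversions (`√(C·e^{L+t/2}/N) ≤ √C·e^{−t/4}` for `N ≥ e^{L+t}`; `ν{e^{L+t/2} < ρ} ≤ ν{L+t/2 < log ρ}`);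
* **`sampleSize_sufficient_of_varianceInflation`** — `f ∈ L²(ν)` measurable;
  `Var_Q(Σᵢ g(xᵢ)) ≤ C·N·Var_μ(g)` for every `g ∈ L²(μ)`; any real `t`, `N ≥ e^{L + t}` ⇒
  `∫ |I_N(f) − ∫ f dν| dQ ≤ ‖f‖_{L²(ν)}·(√C·e^{−t/4} + 2·√(ν{L + t/2 < log ρ}))`;
* **`sampleSize_sufficient_of_varianceInflation_bdd`** — `f` measurable with `|f| ≤ B`; the
  variance inflation assumed only for bounded measurable `g`; same conclusion.
§2 (Crooks pairs):
* **`CrooksPair.sampleSize_sufficient_of_varianceInflation`** — measurable `f ∈ L²(P_R)`, any real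
  `t`, `N ≥ exp(E_{P_R}[ΔF − W] + t)` ⇒
  `E_Q|(1/N)Σᵢ f(εᵢ)e^{ΔF − W(εᵢ)} − E_{P_R} f| ≤ ‖f‖_{L²(P_R)}·(√C·e^{−t/4} + 2√(P_R{E_{P_R}[ΔF − W] + t/2 < ΔF − W}))`
  — `Exactness/NCMCGeneralSpaceSampleSize.sampleSize_sufficient` (independent records) with `N`
  replaced by `N/C`;
* **`CrooksPair.sampleSize_sufficient_of_varianceInflation_bdd`** — the same for bounded measurable
  `f`, variance inflation on bounded observables only (Doeblin class; `f = 1` is the Jarzynski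
  estimator itself);
* **`CrooksPair.sampleSize_sufficient_of_varianceInflation_of_essPop`** — the `L²` form under
  `N ≥ e^{t}/ESS_F`, `ESS_F = (E_{P_F}e^{−W})²/E_{P_F}e^{−2W}` (row 13's
  `essPop_le_exp_neg_rev_dissipation`: `E_{P_R}[ΔF − W] ≤ −log ESS_F`).

Reading (value-free): `C = 1` is the independent case (the Literature theorem's first display
verbatim); for a stationary chain of launches `C` is an integrated-autocorrelation factor, so the
law says `N_eff = N/C ≥ e^{L + t}` effective evolutions suffice; `C` is an INPUT here (a Doeblin
constant of the PRIOR sampler bounds it: `Exactness/NCMCGeneralSpaceRestartChainSampleSize`).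
NOT CLAIMED: any value of `C` for a concrete chain; the necessity half
(`Exactness/NCMCGeneralSpaceSampleSizeMarginals`, marginals alone).
-/

namespace Summit.Ventures.LatticeQCDFlow.Exactness.GeneralNCMC

open MeasureTheory ProbabilityTheory Set Filter
open scoped ENNReal
open Literature.Probability.ImportanceSampling (isEstimate)

/-! ## §1 Class forms of the correlated-draws sufficiency law -/

section Forms

variable {𝓧 : Type*} [MeasurableSpace 𝓧]

/-- Threshold-to-sample-size conversion: with `a = e^{L + t/2}` and `N ≥ e^{L + t}`,
`√(C·a/N) ≤ √C·e^{−t/4}`. -/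
theorem sqrt_mul_threshold_div_le {C L t : ℝ} (hC : 0 ≤ C) {N : ℕ}
    (hN : Real.exp (L + t) ≤ N) :
    Real.sqrt (C * Real.exp (L + t / 2) / N) ≤ Real.sqrt C * Real.exp (-t / 4) := by
  have hNR : (0:ℝ) < N := lt_of_lt_of_le (Real.exp_pos _) hN
  have han : Real.exp (L + t / 2) / N ≤ Real.exp (-t / 2) := by
    rw [div_le_iff₀ hNR]
    calc Real.exp (L + t / 2) = Real.exp (-t / 2) * Real.exp (L + t) := by
          rw [← Real.exp_add]; congr 1; ring
      _ ≤ Real.exp (-t / 2) * N := by gcongr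
  have hsq : Real.exp (-t / 2) = Real.exp (-t / 4) ^ 2 := by
    rw [sq, ← Real.exp_add]; congr 1; ring
  calc Real.sqrt (C * Real.exp (L + t / 2) / N)
      = Real.sqrt C * Real.sqrt (Real.exp (L + t / 2) / N) := by
        rw [mul_div_assoc, Real.sqrt_mul hC]
    _ ≤ Real.sqrt C * Real.sqrt (Real.exp (-t / 2)) := by gcongr
    _ = Real.sqrt C * Real.exp (-t / 4) := by rw [hsq, Real.sqrt_sq (Real.exp_pos _).le]

/-- Threshold-to-sample-size conversion for the tail: `{a < ρ} ⊆ {log a < log ρ}`, so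
`ν{e^{L + t/2} < ρ} ≤ ν{L + t/2 < log ρ}` (in `ℝ`). -/
theorem toReal_measure_threshold_le_log (ν μ : Measure 𝓧) [IsFiniteMeasure ν] (L t : ℝ) :
    (ν {y | Real.exp (L + t / 2) < (ν.rnDeriv μ y).toReal}).toReal ≤
      (ν {y | L + t / 2 < Real.log (ν.rnDeriv μ y).toReal}).toReal := by
  apply ENNReal.toReal_mono (measure_ne_top _ _)
  apply measure_mono
  intro y hy
  simp only [Set.mem_setOf_eq] at hy ⊢
  have hlog : Real.log (Real.exp (L + t / 2)) = L + t / 2 := Real.log_exp _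
  rw [← hlog]
  exact Real.log_lt_log (Real.exp_pos _) hy

/-- **SUFFICIENCY, CORRELATED DRAWS, `L²` CLASS.**  Probability measures `ν ≪ μ`, `ρ = dν/dμ`,
`L = ∫ log ρ dν`, measurable `f ∈ L²(ν)`; a probability measure `Q` on `Fin N → 𝓧` with `μ`
marginals and `Var_Q(Σᵢ g(xᵢ)) ≤ C·N·Var_μ(g)` for every `g ∈ L²(μ)`; any real `t` with
`N ≥ e^{L + t}`.  Then
`∫ |I_N(f) − ∫ f dν| dQ ≤ ‖f‖_{L²(ν)}·(√C·e^{−t/4} + 2·√(ν{L + t/2 < log ρ}))` — Chatterjee–Diaconis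
Thm 1.1 (first display) with `N` replaced by `N/C`. -/
theorem sampleSize_sufficient_of_varianceInflation (μ ν : Measure 𝓧)
    [IsProbabilityMeasure μ] [IsProbabilityMeasure ν] (hνμ : ν ≪ μ)
    {f : 𝓧 → ℝ} (hf : Measurable f) (hf2 : MemLp f 2 ν)
    {N : ℕ} (Q : Measure (Fin N → 𝓧)) [IsProbabilityMeasure Q]
    (hmarg : ∀ i : Fin N, Q.map (fun x => x i) = μ)
    {C : ℝ} (hC : 0 ≤ C)
    (hvar : ∀ g : 𝓧 → ℝ, MemLp g 2 μ →
      Var[fun x : Fin N → 𝓧 => ∑ i, g (x i); Q] ≤ C * N * Var[g; μ])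
    {t : ℝ} (hN : Real.exp ((∫ y, Real.log (ν.rnDeriv μ y).toReal ∂ν) + t) ≤ N) :
    ∫ x, |isEstimate μ ν f N x - ∫ y, f y ∂ν| ∂Q ≤
      Real.sqrt (∫ y, f y ^ 2 ∂ν) *
        (Real.sqrt C * Real.exp (-t / 4)
          + 2 * Real.sqrt (ν {y | (∫ z, Real.log (ν.rnDeriv μ z).toReal ∂ν) + t / 2
              < Real.log (ν.rnDeriv μ y).toReal}).toReal) := by
  set L := ∫ y, Real.log (ν.rnDeriv μ y).toReal ∂ν with hL
  have ha : 0 < Real.exp (L + t / 2) := Real.exp_pos _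
  have hNR : (0:ℝ) < N := lt_of_lt_of_le (Real.exp_pos _) hN
  have hN0 : N ≠ 0 := by rintro rfl; simp at hNR
  have key := sampleSize_sufficient_threshold_of_varianceBound μ ν hνμ hf hf2 hN0 Q hmarg hC ha
    (hvar (fun y => {y | (ν.rnDeriv μ y).toReal ≤ Real.exp (L + t / 2)}.indicator f y
      * (ν.rnDeriv μ y).toReal) (memLp_two_truncWeight μ ν hνμ hf hf2 ha.le))
  refine le_trans key (mul_le_mul_of_nonneg_left ?_ (Real.sqrt_nonneg _))
  exact add_le_add (sqrt_mul_threshold_div_le hC hN) (mul_le_mul_of_nonneg_left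
    (Real.sqrt_le_sqrt (toReal_measure_threshold_le_log ν μ L t)) zero_le_two)

/-- **SUFFICIENCY, CORRELATED DRAWS, BOUNDED CLASS.**  As above for a measurable `f` with `|f| ≤ B`
(so `f ∈ L²(ν)`), assuming the variance inflation `Var_Q(Σᵢ g(xᵢ)) ≤ C·N·Var_μ(g)` only for
BOUNDED measurable `g` — the class delivered by Doeblin / minorisation arguments (row 8's
`Scoring/RestartChainAutocorrelation.abs_autocov_restart_le_of_doeblin`). -/
theorem sampleSize_sufficient_of_varianceInflation_bdd (μ ν : Measure 𝓧)
    [IsProbabilityMeasure μ] [IsProbabilityMeasure ν] (hνμ : ν ≪ μ)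
    {f : 𝓧 → ℝ} (hf : Measurable f) {B : ℝ} (hB : ∀ y, |f y| ≤ B)
    {N : ℕ} (Q : Measure (Fin N → 𝓧)) [IsProbabilityMeasure Q]
    (hmarg : ∀ i : Fin N, Q.map (fun x => x i) = μ)
    {C : ℝ} (hC : 0 ≤ C)
    (hvar : ∀ g : 𝓧 → ℝ, Measurable g → ∀ B' : ℝ, (∀ y, |g y| ≤ B') →
      Var[fun x : Fin N → 𝓧 => ∑ i, g (x i); Q] ≤ C * N * Var[g; μ])
    {t : ℝ} (hN : Real.exp ((∫ y, Real.log (ν.rnDeriv μ y).toReal ∂ν) + t) ≤ N) :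
    ∫ x, |isEstimate μ ν f N x - ∫ y, f y ∂ν| ∂Q ≤
      Real.sqrt (∫ y, f y ^ 2 ∂ν) *
        (Real.sqrt C * Real.exp (-t / 4)
          + 2 * Real.sqrt (ν {y | (∫ z, Real.log (ν.rnDeriv μ z).toReal ∂ν) + t / 2
              < Real.log (ν.rnDeriv μ y).toReal}).toReal) := by
  set L := ∫ y, Real.log (ν.rnDeriv μ y).toReal ∂ν with hL
  have ha : 0 < Real.exp (L + t / 2) := Real.exp_pos _
  have hNR : (0:ℝ) < N := lt_of_lt_of_le (Real.exp_pos _) hN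
  have hN0 : N ≠ 0 := by rintro rfl; simp at hNR
  have hf2 : MemLp f 2 ν := MemLp.of_bound hf.aestronglyMeasurable B
    (ae_of_all _ fun y => by rw [Real.norm_eq_abs]; exact hB y)
  have hρm : Measurable fun y => (ν.rnDeriv μ y).toReal :=
    (Measure.measurable_rnDeriv ν μ).ennreal_toReal
  have hgm : Measurable fun y => {y | (ν.rnDeriv μ y).toReal ≤ Real.exp (L + t / 2)}.indicator f y
      * (ν.rnDeriv μ y).toReal :=
    (hf.indicator (measurableSet_le hρm measurable_const)).mul hρm
  have key := sampleSize_sufficient_threshold_of_varianceBound μ ν hνμ hf hf2 hN0 Q hmarg hC ha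
    (hvar (fun y => {y | (ν.rnDeriv μ y).toReal ≤ Real.exp (L + t / 2)}.indicator f y
      * (ν.rnDeriv μ y).toReal) hgm (B * Real.exp (L + t / 2))
      (abs_truncWeight_le μ ν hB ha.le))
  refine le_trans key (mul_le_mul_of_nonneg_left ?_ (Real.sqrt_nonneg _))
  exact add_le_add (sqrt_mul_threshold_div_le hC hN) (mul_le_mul_of_nonneg_left
    (Real.sqrt_le_sqrt (toReal_measure_threshold_le_log ν μ L t)) zero_le_two)

end Forms

/-! ## §2 Crooks pairs: correlated forward records with `P_F` marginals -/

variable {Ω E : Type*} [MeasurableSpace Ω] [MeasurableSpace E]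

namespace CrooksPair

variable {ν₀ ν₁ : Measure Ω} {κF κR : Kernel Ω E} {s e : E → Ω} {W : E → ℝ}

/-- **JARZYNSKI / REWEIGHTING SAMPLE SIZE, SUFFICIENCY, CORRELATED RECORDS (general state
space).**  For a Crooks pair (`P_F = fwdPathLaw ν₀ κF`, `P_R = fwdPathLaw ν₁ κR`,
`e^{−ΔF} = Z₁/Z₀`), a measurable `f ∈ L²(P_R)`, and ANY probability law `Q` of `N` forward records
whose one-record marginals are all `P_F` (e.g. the records launched from a STATIONARY prior chain)
with variance inflation `C ≥ 0` (`Var_Q(Σᵢ g(εᵢ)) ≤ C·N·Var_{P_F}(g)` for every `g ∈ L²(P_F)`);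
any real `t` with `N ≥ exp(E_{P_R}[ΔF − W] + t)`.  Then
`E_Q|(1/N)Σᵢ f(εᵢ)e^{ΔF − W(εᵢ)} − E_{P_R} f| ≤ ‖f‖_{L²(P_R)}·(√C·e^{−t/4} + 2√(P_R{E_{P_R}[ΔF − W] + t/2 < ΔF − W}))`
— `Exactness/NCMCGeneralSpaceSampleSize.sampleSize_sufficient` with `N` replaced by `N/C`, minus
independence. -/
theorem sampleSize_sufficient_of_varianceInflation [IsFiniteMeasure ν₀] [IsFiniteMeasure ν₁]
    [IsMarkovKernel κF] [IsMarkovKernel κR] (h0 : ν₀ univ ≠ 0) (h1 : ν₁ univ ≠ 0)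
    (h : CrooksPair ν₀ ν₁ κF κR s e W) {ΔF : ℝ}
    (hΔF : Real.exp (-ΔF) = ((ν₀ univ)⁻¹ * ν₁ univ).toReal)
    {f : E → ℝ} (hf : Measurable f) (hf2 : MemLp f 2 (fwdPathLaw ν₁ κR))
    {N : ℕ} (Q : Measure (Fin N → E)) [IsProbabilityMeasure Q]
    (hmarg : ∀ i : Fin N, Q.map (fun x => x i) = fwdPathLaw ν₀ κF)
    {C : ℝ} (hC : 0 ≤ C)
    (hvar : ∀ g : E → ℝ, MemLp g 2 (fwdPathLaw ν₀ κF) →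
      Var[fun x : Fin N → E => ∑ i, g (x i); Q] ≤ C * N * Var[g; fwdPathLaw ν₀ κF])
    {t : ℝ} (hN : Real.exp ((∫ ε, (ΔF - W ε) ∂(fwdPathLaw ν₁ κR)) + t) ≤ N) :
    ∫ x, |(1 / (N : ℝ)) * ∑ i, f (x i) * Real.exp (ΔF - W (x i)) - ∫ ε, f ε ∂(fwdPathLaw ν₁ κR)| ∂Q
      ≤ Real.sqrt (∫ ε, f ε ^ 2 ∂(fwdPathLaw ν₁ κR)) *
          (Real.sqrt C * Real.exp (-t / 4) + 2 * Real.sqrt ((fwdPathLaw ν₁ κR)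
            {ε | (∫ ε', (ΔF - W ε') ∂(fwdPathLaw ν₁ κR)) + t / 2 < ΔF - W ε}).toReal) := by
  haveI := isProbabilityMeasure_fwdPathLaw ν₀ h0 κF
  haveI := isProbabilityMeasure_fwdPathLaw ν₁ h1 κR
  -- `dP_R/dP_F = e^{ΔF − W}` a.e. and the exponent `∫ log(dP_R/dP_F) dP_R = E_{P_R}[ΔF − W]`
  have hmeas : Measurable fun ε => ENNReal.ofReal (Real.exp (ΔF - W ε)) :=
    Measurable.ennreal_ofReal (by have := h.measurable_W; fun_prop)
  have hrn : (fwdPathLaw ν₁ κR).rnDeriv (fwdPathLaw ν₀ κF)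
      =ᵐ[fwdPathLaw ν₀ κF] fun ε => ENNReal.ofReal (Real.exp (ΔF - W ε)) := by
    have hr := Measure.rnDeriv_withDensity (fwdPathLaw ν₀ κF) hmeas
    rwa [← h.revPathLaw_eq_withDensity h0 h1 hΔF] at hr
  have hkl : ∫ ε, Real.log ((fwdPathLaw ν₁ κR).rnDeriv (fwdPathLaw ν₀ κF) ε).toReal
      ∂(fwdPathLaw ν₁ κR) = ∫ ε, (ΔF - W ε) ∂(fwdPathLaw ν₁ κR) :=
    integral_congr_ae (h.llr_rev_fwd h0 h1 hΔF)
  have hgen := GeneralNCMC.sampleSize_sufficient_of_varianceInflation (fwdPathLaw ν₀ κF)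
    (fwdPathLaw ν₁ κR) (h.revPathLaw_absolutelyContinuous h0 h1) hf hf2 Q hmarg hC hvar
    (t := t) (by rwa [hkl])
  rw [hkl] at hgen
  -- the integrand, up to a `Q`-null set (each coordinate's density is `e^{ΔF − W}` `P_F`-a.e.)
  have hae : ∀ᵐ x ∂Q, ∀ i : Fin N,
      ((fwdPathLaw ν₁ κR).rnDeriv (fwdPathLaw ν₀ κF) (x i)).toReal = Real.exp (ΔF - W (x i)) := by
    rw [ae_all_iff]
    intro i
    have hq : Measure.QuasiMeasurePreserving (fun x : Fin N → E => x i) Q (fwdPathLaw ν₀ κF) := by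
      refine ⟨measurable_pi_apply i, ?_⟩
      rw [hmarg i]
    filter_upwards [hq.ae_eq hrn] with x hx
    have hx' : (fwdPathLaw ν₁ κR).rnDeriv (fwdPathLaw ν₀ κF) (x i)
        = ENNReal.ofReal (Real.exp (ΔF - W (x i))) := hx
    rw [hx', ENNReal.toReal_ofReal (Real.exp_pos _).le]
  have hint : (fun x : Fin N → E => |isEstimate (fwdPathLaw ν₀ κF) (fwdPathLaw ν₁ κR) f N x
        - ∫ ε, f ε ∂(fwdPathLaw ν₁ κR)|)
      =ᵐ[Q] fun x => |(1 / (N : ℝ)) * ∑ i, f (x i) * Real.exp (ΔF - W (x i))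
          - ∫ ε, f ε ∂(fwdPathLaw ν₁ κR)| := by
    filter_upwards [hae] with x hx
    simp only [isEstimate]
    rw [Finset.sum_congr rfl fun i _ => by rw [hx i]]
  -- the tail event, up to a `P_R`-null set
  have htail : {ε | (∫ ε', (ΔF - W ε') ∂(fwdPathLaw ν₁ κR)) + t / 2
        < Real.log ((fwdPathLaw ν₁ κR).rnDeriv (fwdPathLaw ν₀ κF) ε).toReal}
      =ᵐ[fwdPathLaw ν₁ κR]
        ({ε | (∫ ε', (ΔF - W ε') ∂(fwdPathLaw ν₁ κR)) + t / 2 < ΔF - W ε} : Set E) := by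
    filter_upwards [h.llr_rev_fwd h0 h1 hΔF] with ε hε
    simp only [eq_iff_iff]
    dsimp only [setOf]
    rw [← hε, llr]
  rw [integral_congr_ae hint, measure_congr htail] at hgen
  exact hgen

/-- **JARZYNSKI / REWEIGHTING SAMPLE SIZE, SUFFICIENCY, CORRELATED RECORDS — BOUNDED CLASS.**
The same for a BOUNDED measurable `f` (`|f| ≤ B`), assuming the variance inflation
`Var_Q(Σᵢ g(εᵢ)) ≤ C·N·Var_{P_F}(g)` only for bounded measurable `g` — the class a Doeblin
(minorisation) constant of the chain of records delivers (row 11's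
`Scoring/ChainTimeAverage.variance_timeAverage_le_of_doeblin`: `C = 2/ε − 1`).  `f = 1` is the
Jarzynski estimator itself: `E_Q|Ẑ_N e^{ΔF} − 1| ≤ √C e^{−t/4} + 2√(P_R{…})`. -/
theorem sampleSize_sufficient_of_varianceInflation_bdd [IsFiniteMeasure ν₀] [IsFiniteMeasure ν₁]
    [IsMarkovKernel κF] [IsMarkovKernel κR] (h0 : ν₀ univ ≠ 0) (h1 : ν₁ univ ≠ 0)
    (h : CrooksPair ν₀ ν₁ κF κR s e W) {ΔF : ℝ}
    (hΔF : Real.exp (-ΔF) = ((ν₀ univ)⁻¹ * ν₁ univ).toReal)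
    {f : E → ℝ} (hf : Measurable f) {B : ℝ} (hB : ∀ ε, |f ε| ≤ B)
    {N : ℕ} (Q : Measure (Fin N → E)) [IsProbabilityMeasure Q]
    (hmarg : ∀ i : Fin N, Q.map (fun x => x i) = fwdPathLaw ν₀ κF)
    {C : ℝ} (hC : 0 ≤ C)
    (hvar : ∀ g : E → ℝ, Measurable g → ∀ B' : ℝ, (∀ ε, |g ε| ≤ B') →
      Var[fun x : Fin N → E => ∑ i, g (x i); Q] ≤ C * N * Var[g; fwdPathLaw ν₀ κF])
    {t : ℝ} (hN : Real.exp ((∫ ε, (ΔF - W ε) ∂(fwdPathLaw ν₁ κR)) + t) ≤ N) :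
    ∫ x, |(1 / (N : ℝ)) * ∑ i, f (x i) * Real.exp (ΔF - W (x i)) - ∫ ε, f ε ∂(fwdPathLaw ν₁ κR)| ∂Q
      ≤ Real.sqrt (∫ ε, f ε ^ 2 ∂(fwdPathLaw ν₁ κR)) *
          (Real.sqrt C * Real.exp (-t / 4) + 2 * Real.sqrt ((fwdPathLaw ν₁ κR)
            {ε | (∫ ε', (ΔF - W ε') ∂(fwdPathLaw ν₁ κR)) + t / 2 < ΔF - W ε}).toReal) := by
  haveI := isProbabilityMeasure_fwdPathLaw ν₀ h0 κF
  haveI := isProbabilityMeasure_fwdPathLaw ν₁ h1 κR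
  have hmeas : Measurable fun ε => ENNReal.ofReal (Real.exp (ΔF - W ε)) :=
    Measurable.ennreal_ofReal (by have := h.measurable_W; fun_prop)
  have hrn : (fwdPathLaw ν₁ κR).rnDeriv (fwdPathLaw ν₀ κF)
      =ᵐ[fwdPathLaw ν₀ κF] fun ε => ENNReal.ofReal (Real.exp (ΔF - W ε)) := by
    have hr := Measure.rnDeriv_withDensity (fwdPathLaw ν₀ κF) hmeas
    rwa [← h.revPathLaw_eq_withDensity h0 h1 hΔF] at hr
  have hkl : ∫ ε, Real.log ((fwdPathLaw ν₁ κR).rnDeriv (fwdPathLaw ν₀ κF) ε).toReal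
      ∂(fwdPathLaw ν₁ κR) = ∫ ε, (ΔF - W ε) ∂(fwdPathLaw ν₁ κR) :=
    integral_congr_ae (h.llr_rev_fwd h0 h1 hΔF)
  have hgen := GeneralNCMC.sampleSize_sufficient_of_varianceInflation_bdd (fwdPathLaw ν₀ κF)
    (fwdPathLaw ν₁ κR) (h.revPathLaw_absolutelyContinuous h0 h1) hf hB Q hmarg hC hvar
    (t := t) (by rwa [hkl])
  rw [hkl] at hgen
  have hae : ∀ᵐ x ∂Q, ∀ i : Fin N,
      ((fwdPathLaw ν₁ κR).rnDeriv (fwdPathLaw ν₀ κF) (x i)).toReal = Real.exp (ΔF - W (x i)) := by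
    rw [ae_all_iff]
    intro i
    have hq : Measure.QuasiMeasurePreserving (fun x : Fin N → E => x i) Q (fwdPathLaw ν₀ κF) := by
      refine ⟨measurable_pi_apply i, ?_⟩
      rw [hmarg i]
    filter_upwards [hq.ae_eq hrn] with x hx
    have hx' : (fwdPathLaw ν₁ κR).rnDeriv (fwdPathLaw ν₀ κF) (x i)
        = ENNReal.ofReal (Real.exp (ΔF - W (x i))) := hx
    rw [hx', ENNReal.toReal_ofReal (Real.exp_pos _).le]
  have hint : (fun x : Fin N → E => |isEstimate (fwdPathLaw ν₀ κF) (fwdPathLaw ν₁ κR) f N x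
        - ∫ ε, f ε ∂(fwdPathLaw ν₁ κR)|)
      =ᵐ[Q] fun x => |(1 / (N : ℝ)) * ∑ i, f (x i) * Real.exp (ΔF - W (x i))
          - ∫ ε, f ε ∂(fwdPathLaw ν₁ κR)| := by
    filter_upwards [hae] with x hx
    simp only [isEstimate]
    rw [Finset.sum_congr rfl fun i _ => by rw [hx i]]
  have htail : {ε | (∫ ε', (ΔF - W ε') ∂(fwdPathLaw ν₁ κR)) + t / 2
        < Real.log ((fwdPathLaw ν₁ κR).rnDeriv (fwdPathLaw ν₀ κF) ε).toReal}
      =ᵐ[fwdPathLaw ν₁ κR]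
        ({ε | (∫ ε', (ΔF - W ε') ∂(fwdPathLaw ν₁ κR)) + t / 2 < ΔF - W ε} : Set E) := by
    filter_upwards [h.llr_rev_fwd h0 h1 hΔF] with ε hε
    simp only [eq_iff_iff]
    dsimp only [setOf]
    rw [← hε, llr]
  rw [integral_congr_ae hint, measure_congr htail] at hgen
  exact hgen

/-- **`N ≥ e^{t}/ESS_F` CORRELATED FORWARD RECORDS SUFFICE, up to the factor `√C`** — the same
with the exponent replaced by the population ESS of the forward weights,
`ESS_F = (E_{P_F} e^{−W})²/E_{P_F} e^{−2W}` (`E_{P_R}[ΔF − W] ≤ −log ESS_F` is row 13's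
`essPop_le_exp_neg_rev_dissipation`): with `N ≥ e^t/ESS_F` records of `P_F` marginals and variance
inflation `C`, the reweighting error is `≤ ‖f‖_{L²(P_R)}·(√C e^{−t/4} + 2√(tail))`; equivalently
`N_eff = N/C ≥ e^{t}/ESS_F` effective records give the independent-records bound. -/
theorem sampleSize_sufficient_of_varianceInflation_of_essPop [IsFiniteMeasure ν₀]
    [IsFiniteMeasure ν₁] [IsMarkovKernel κF] [IsMarkovKernel κR] (h0 : ν₀ univ ≠ 0)
    (h1 : ν₁ univ ≠ 0) (h : CrooksPair ν₀ ν₁ κF κR s e W) {ΔF : ℝ}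
    (hΔF : Real.exp (-ΔF) = ((ν₀ univ)⁻¹ * ν₁ univ).toReal)
    {f : E → ℝ} (hf : Measurable f) (hf2 : MemLp f 2 (fwdPathLaw ν₁ κR))
    {N : ℕ} (Q : Measure (Fin N → E)) [IsProbabilityMeasure Q]
    (hmarg : ∀ i : Fin N, Q.map (fun x => x i) = fwdPathLaw ν₀ κF)
    {C : ℝ} (hC : 0 ≤ C)
    (hvar : ∀ g : E → ℝ, MemLp g 2 (fwdPathLaw ν₀ κF) →
      Var[fun x : Fin N → E => ∑ i, g (x i); Q] ≤ C * N * Var[g; fwdPathLaw ν₀ κF])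
    {t : ℝ}
    (hE : 0 < (∫ ε, Real.exp (-W ε) ∂(fwdPathLaw ν₀ κF)) ^ 2
      / ∫ ε, Real.exp (-(2 * W ε)) ∂(fwdPathLaw ν₀ κF))
    (hN : Real.exp t / ((∫ ε, Real.exp (-W ε) ∂(fwdPathLaw ν₀ κF)) ^ 2
      / ∫ ε, Real.exp (-(2 * W ε)) ∂(fwdPathLaw ν₀ κF)) ≤ N) :
    ∫ x, |(1 / (N : ℝ)) * ∑ i, f (x i) * Real.exp (ΔF - W (x i)) - ∫ ε, f ε ∂(fwdPathLaw ν₁ κR)| ∂Q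
      ≤ Real.sqrt (∫ ε, f ε ^ 2 ∂(fwdPathLaw ν₁ κR)) *
          (Real.sqrt C * Real.exp (-t / 4) + 2 * Real.sqrt ((fwdPathLaw ν₁ κR)
            {ε | (∫ ε', (ΔF - W ε') ∂(fwdPathLaw ν₁ κR)) + t / 2 < ΔF - W ε}).toReal) := by
  refine h.sampleSize_sufficient_of_varianceInflation h0 h1 hΔF hf hf2 Q hmarg hC hvar
    (le_trans ?_ hN)
  have hb := h.essPop_le_exp_neg_rev_dissipation h0 h1 hΔF
  set ESS := (∫ ε, Real.exp (-W ε) ∂(fwdPathLaw ν₀ κF)) ^ 2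
      / ∫ ε, Real.exp (-(2 * W ε)) ∂(fwdPathLaw ν₀ κF) with hESS
  have hL : ∫ ε, (ΔF - W ε) ∂(fwdPathLaw ν₁ κR) ≤ -Real.log ESS := by
    have := Real.log_le_log hE hb
    rw [Real.log_exp] at this
    linarith
  calc Real.exp ((∫ ε, (ΔF - W ε) ∂(fwdPathLaw ν₁ κR)) + t)
      ≤ Real.exp (-Real.log ESS + t) := Real.exp_le_exp.mpr (by linarith)
    _ = Real.exp t / ESS := by rw [Real.exp_add, Real.exp_neg, Real.exp_log hE, inv_mul_eq_div]

end CrooksPair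

end Summit.Ventures.LatticeQCDFlow.Exactness.GeneralNCMC
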